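import Summits.ResolutionOfSingularities.ResolutionOfSingularities.Theorems.EquisingularLiftEquisingularLiftNatMarkedTower
import Summits.ResolutionOfSingularities.ResolutionOfSingularities.Theorems.EquisingularLiftEquisingularLiftNatDSeriesCharts
import Literature.AlgebraicGeometry.Resolution.CompletedPullbackRegular
import Literature.AlgebraicGeometry.Resolution.PowerSeriesRegularLocal
import Literature.RingTheory.MvPolynomial.VariableIdeals
import HarnessLib

/-!
# [OURS] NEGATIVE SIDE OF THE DEPTH PROGRAMME: a strict transform that is singular along a CURVE inside the exceptional divisor gives a point of
# NO finite blow-up depth — and `x² + y³z + z⁵` is an ISOLATED double point of infinite depth in every blow-up tower (every field)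
# (cruxes `Theses.EquisingularLift.EquisingularLiftNat` / `…NatThree` / `EquisingularLift`, stmt-ResolutionOfSingularities-20038 / -20148 / -15660)

[OURS · leafhand-res-equisingularlift-12 g1, 2026-09-01; cell `pub/decomp-res`] AI-produced, weaker than expert review; NOT a statement of any manuscript;
nothing here proves resolution of singularities in positive characteristic.  DEF-FREE helper; no `sorry`; standard axioms; ZERO named hypotheses.

The tower levels `D n` of the depth programme (✓ `exists_blowupTower`) ask at level `0` that every blow-up at the point be regular over it, and at level
`d + 1` that its non-regular points over the point be FINITELY many CLOSED points of level `≤ d`.  If some chart `a` of the blow-up of the origin of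
`Spec K[y]/(Φ + Ψ)` carries a strict transform `G_a` lying in the SQUARE of a NON-MAXIMAL prime `P ∋ T_a` (a curve of singular points inside the
exceptional divisor), then the image of the generic point of `V(P)` is a non-regular, non-closed point of the model blow-up over the origin: no level at all.

* `OneStep.exists_chart_index` — the chart `Spec (A/(f))[Ī/ȳ_a] → Bl` for a PRESCRIBED index `a` (open immersion over the base; ✓
  `IsBlowup.exists_chart_of_span_range_eq` produces it for the chart through a given point);
* ★★★ `OneStep.towerLevel_none_origin_of_mem_sq` — the criterion above: `∀ n, ¬ D n (Spec K[y]/(Φ + Ψ)) y₀`;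
* ★★★ `OneStep.towerLevel_none_origin_E12blowup` — `f = y₂² + (y₀³y₁ + y₁⁵)` (`x² + y³z + z⁵`, the first blow-up of the `E₁₂`-type point `x² + y³ + z⁷`;
  an isolated double point in every characteristic): chart `1` carries `T₂² + T₁²(T₀³ + T₁) ∈ (T₁, T₂)²`, so its origin has NO `D`-level, for every
  blow-up tower `D` and every field `K`.

Consequence for the lead / planner (honest): the consumer ✓ `isoHypPoint_of_towerPoints` can never certify a surface with such a point; the isolated
residual of `stub_elnat_three_isolated…` is not exhausted by finite-depth classes.  Closes no registered stub.

References: [StacksProject, Tags 0804, 080E]; [Matsumura1987, Thm. 14.2]; [Hartshorne1977, II Ex. 7.12]; through the cited tree files.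
-/

set_option linter.dupNamespace false -- mandated namespace `Summit.<Summit>.<Problem>` of this single-conjunct summit

noncomputable section

open CategoryTheory CategoryTheory.Limits AlgebraicGeometry TopologicalSpace Topology
open MvPolynomial
open Literature.AlgebraicGeometry.Resolution
open AlgebraicGeometry.Scheme.IdealSheafData
open Summit.ResolutionOfSingularities.ResolutionOfSingularities.Cruxes.EquisingularLiftNat.Sections.ND

namespace Summit.ResolutionOfSingularities.ResolutionOfSingularities.Cruxes.EquisingularLiftNat.Sections

namespace OneStep

universe u

/-- **The chart of a blow-up of `Spec A` for a PRESCRIBED generator** (Stacks 0804): for a blow-up `ρ : B → Spec A` along `Ĩ`, `I = (g_j)_j`, and any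
index `j`, an open immersion `Spec A[I/g_j] → B` over `Spec A`. [cite: StacksProject, Tag 0804] -/
theorem exists_chart_index {A : CommRingCat.{u}} {B : Scheme.{u}} {ρ : B ⟶ Spec A} {I : Ideal A}
    (hρ : IsBlowup ρ (Scheme.IdealSheafData.ofIdealTop (I.map (Scheme.ΓSpecIso A).inv.hom)))
    {κ : Type*} (g : κ → A) (hg : Ideal.span (Set.range g) = I) (j : κ) :
    ∃ (φ : Spec (.of (blowupAlgebra I (g j))) ⟶ B) (_ : IsOpenImmersion φ),
      φ ≫ ρ = Spec.map (CommRingCat.ofHom (algebraMap A (blowupAlgebra I (g j)))) := by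
  classical
  set e : (A : Type u) →+* Γ(Spec A, ⊤) := (Scheme.ΓSpecIso A).inv.hom with he
  set J : Ideal Γ(Spec A, ⊤) := I.map e with hJ
  set C := Scheme.IdealSheafData.ofIdealTop J with hC
  let U : (Spec A).affineOpens := ⟨⊤, isAffineOpen_top _⟩
  have hCU : C.ideal U = J := by simp [hC, U]
  have hebij : Function.Bijective e :=
    (Scheme.ΓSpecIso A).symm.commRingCatIsoToRingEquiv.bijective
  let x : κ → Γ(Spec A, ⊤) := fun j => e (g j)
  have hx : Ideal.span (Set.range x) = C.ideal U := by
    rw [hCU, hJ, ← hg, Ideal.map_span, ← Set.range_comp]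
    rfl
  have hxj : x j ∈ C.ideal U := hx ▸ Ideal.subset_span (Set.mem_range_self j)
  obtain ⟨φ₀, _, hφ₀r, hφ₀⟩ := hρ.exists_blowupAlgebra_chart_opensRange_eq U (x j) hxj
  have hIJ : I.map e ≤ C.ideal U := by rw [hCU]
  have hJI : C.ideal U ≤ I.map e := by rw [hCU]
  let β := blowupAlgebraMap e I (C.ideal U) (g j) hIJ
  have hβ : Function.Bijective β := blowupAlgebraMap_bijective e hebij I (C.ideal U) (g j) hIJ hJI
  let ε : CommRingCat.of (blowupAlgebra I (g j)) ≅ CommRingCat.of (blowupAlgebra (C.ideal U) (x j)) :=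
    (RingEquiv.ofBijective β hβ).toCommRingCatIso
  refine ⟨Spec.map ε.inv ≫ φ₀, inferInstance, ?_⟩
  have hfS : U.2.fromSpec = Spec.map (Scheme.ΓSpecIso A).inv :=
    (IsAffineOpen.fromSpec_top (X := Spec A)).trans (Scheme.isoSpec_Spec_inv A)
  rw [Category.assoc, hφ₀, hfS, ← Spec.map_comp, ← Spec.map_comp]
  refine congrArg Spec.map ?_
  apply CommRingCat.hom_ext
  apply RingHom.ext
  intro a
  change (RingEquiv.ofBijective β hβ).symm (algebraMap Γ(Spec A, ⊤) _ (e a)) = algebraMap A _ a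
  rw [RingEquiv.symm_apply_eq, RingEquiv.ofBijective_apply]
  exact (blowupAlgebraMap_algebraMap e I (C.ideal U) (g j) hIJ a).symm

variable (K : Type) [Field K] {N : ℕ}

set_option maxHeartbeats 1600000 in -- the chart algebra `blowupAlgebra` is a subalgebra of a localisation: slow instance unification (as in …NatMarkedTower)
/-- ★★★ **A SINGULAR CURVE INSIDE THE EXCEPTIONAL DIVISOR ⟹ NO LEVEL.**  `f = Φ + Ψ` (`Φ ≠ 0` a form of degree `μ ≥ 1`, `Ψ ∈ (y)^{μ+1}`), a chart `a` with
strict transform `G` (`f(T_a, T_aT_j) = T_a^μ·G`, `G ≠ 0`) and a NON-MAXIMAL prime `P ∋ T_a` of `K[T]` with `G ∈ P²`.  Then the origin of `Spec K[y]/(f)` has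
no `D`-level in any blow-up tower `D`: the generic point of `V(P)` maps, under the chart, to a non-regular NON-CLOSED point of the model blow-up over the origin.
[OURS] [cite: StacksProject, Tag 0804] [cite: Matsumura1987, Thm. 14.2] -/
theorem towerLevel_none_origin_of_mem_sq (D : ℕ → ∀ Γ : Scheme.{0}, Γ → Prop)
    (hD0 : ∀ (Γ : Scheme.{0}) (y : Γ), IsClosed (({y} : Set Γ)) →
      (D 0 Γ y ↔ ∀ (hy : IsClosed (({y} : Set Γ))) (Z : Scheme.{0}) (τ : Z ⟶ Γ), IsBlowup τ (vanishingIdeal ⟨{y}, hy⟩) →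
        ∀ z : Z, τ z = y → IsRegularLocalRing (Z.presheaf.stalk z)))
    (hDsucc : ∀ (d : ℕ) (Γ : Scheme.{0}) (y : Γ), IsClosed (({y} : Set Γ)) →
      (D (d + 1) Γ y ↔ ∀ (hy : IsClosed (({y} : Set Γ))) (Z : Scheme.{0}) (τ : Z ⟶ Γ), IsBlowup τ (vanishingIdeal ⟨{y}, hy⟩) →
        ∃ S' : Finset Z, (∀ z : Z, τ z = y → z ∉ S' → IsRegularLocalRing (Z.presheaf.stalk z)) ∧
          ∀ z ∈ S', τ z = y ∧ IsClosed (({z} : Set Z)) ∧ ∃ d' ≤ d, D d' Z z))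
    (Φ Ψ : MvPolynomial (Fin (N + 1)) K) {μ : ℕ} (hμ : 1 ≤ μ) (hΦ : Φ.IsHomogeneous μ) (hΦ0 : Φ ≠ 0)
    (hΨ : Ψ ∈ Ideal.span (Set.range (X : Fin (N + 1) → MvPolynomial (Fin (N + 1)) K)) ^ (μ + 1))
    (a : Fin (N + 1)) (G : MvPolynomial (Fin (N + 1)) K) (hG0 : G ≠ 0)
    (hG : aeval (fun j => X a * Function.update (X : Fin (N + 1) → MvPolynomial (Fin (N + 1)) K) a 1 j) (Φ + Ψ) = X a ^ μ * G)
    (P : Ideal (MvPolynomial (Fin (N + 1)) K)) [hP : P.IsPrime] (hPmax : ¬ P.IsMaximal) (haP : (X a : MvPolynomial (Fin (N + 1)) K) ∈ P)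
    (hGP : G ∈ P ^ 2)
    (y₀ : Spec (CommRingCat.of (MvPolynomial (Fin (N + 1)) K ⧸ Ideal.span {Φ + Ψ})))
    (hy₀ : y₀.asIdeal = Ideal.map (Ideal.Quotient.mk (Ideal.span {Φ + Ψ}))
      (Ideal.span (Set.range (X : Fin (N + 1) → MvPolynomial (Fin (N + 1)) K)))) (n : ℕ) :
    ¬ D n (Spec (CommRingCat.of (MvPolynomial (Fin (N + 1)) K ⧸ Ideal.span {Φ + Ψ}))) y₀ := by
  classical
  -- the origin is a closed point; the model blow-up
  have hmax := isMaximal_map_mk_span_range_X K Φ Ψ hμ hΦ hΨ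
  have hy : IsClosed ({y₀} : Set (Spec (CommRingCat.of (MvPolynomial (Fin (N + 1)) K ⧸ Ideal.span {Φ + Ψ})))) :=
    (PrimeSpectrum.isClosed_singleton_iff_isMaximal y₀).mpr (hy₀ ▸ hmax)
  let τ₀ := blowup.π (vanishingIdeal (⟨{y₀}, hy⟩ : Closeds (Spec (CommRingCat.of (MvPolynomial (Fin (N + 1)) K ⧸ Ideal.span {Φ + Ψ})))))
  have hτ₀ : IsBlowup τ₀ (vanishingIdeal ⟨{y₀}, hy⟩) := blowup.isBlowup _
  have hrad : (Ideal.map (Ideal.Quotient.mk (Ideal.span {Φ + Ψ}))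
      (Ideal.span (Set.range (X : Fin (N + 1) → MvPolynomial (Fin (N + 1)) K)))).IsRadical := hmax.isPrime.isRadical
  have hsing : ({y₀} : Set (Spec (CommRingCat.of (MvPolynomial (Fin (N + 1)) K ⧸ Ideal.span {Φ + Ψ})))) =
      PrimeSpectrum.zeroLocus ((Ideal.map (Ideal.Quotient.mk (Ideal.span {Φ + Ψ}))
        (Ideal.span (Set.range (X : Fin (N + 1) → MvPolynomial (Fin (N + 1)) K))) : Set _)) := by
    rw [← hy₀]
    exact singleton_eq_zeroLocus_of_isMaximal y₀ (hy₀ ▸ hmax)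
  have hC : (⟨{y₀}, hy⟩ : Closeds (Spec (CommRingCat.of (MvPolynomial (Fin (N + 1)) K ⧸ Ideal.span {Φ + Ψ})))) =
      ⟨PrimeSpectrum.zeroLocus ((Ideal.map (Ideal.Quotient.mk (Ideal.span {Φ + Ψ}))
        (Ideal.span (Set.range (X : Fin (N + 1) → MvPolynomial (Fin (N + 1)) K))) : Set _)), PrimeSpectrum.isClosed_zeroLocus _⟩ :=
    Closeds.ext hsing
  have hV : vanishingIdeal (⟨{y₀}, hy⟩ : Closeds (Spec (CommRingCat.of (MvPolynomial (Fin (N + 1)) K ⧸ Ideal.span {Φ + Ψ})))) = (ofIdealTop (Ideal.map (Scheme.ΓSpecIso (CommRingCat.of (MvPolynomial (Fin (N + 1)) K ⧸ Ideal.span {Φ + Ψ}))).inv.hom (Ideal.map (Ideal.Quotient.mk (Ideal.span {Φ + Ψ})) (Ideal.span (Set.range (X : Fin (N + 1) → MvPolynomial (Fin (N + 1)) K)))))) := by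
    rw [hC]
    exact vanishingIdeal_zeroLocus_eq_ofIdealTop_of_isRadical _ hrad
  have hτ₀' : IsBlowup τ₀ (ofIdealTop (Ideal.map (Scheme.ΓSpecIso (CommRingCat.of (MvPolynomial (Fin (N + 1)) K ⧸ Ideal.span {Φ + Ψ}))).inv.hom (Ideal.map (Ideal.Quotient.mk (Ideal.span {Φ + Ψ})) (Ideal.span (Set.range (X : Fin (N + 1) → MvPolynomial (Fin (N + 1)) K)))))) := by
    rw [← hV]; exact hτ₀
  -- the chart `a`
  let g : Fin (N + 1) → (MvPolynomial (Fin (N + 1)) K ⧸ Ideal.span {Φ + Ψ}) := fun i => Ideal.Quotient.mk (Ideal.span {Φ + Ψ}) (X i)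
  have hg : Ideal.span (Set.range g) =
      Ideal.map (Ideal.Quotient.mk (Ideal.span {Φ + Ψ})) (Ideal.span (Set.range (X : Fin (N + 1) → MvPolynomial (Fin (N + 1)) K))) := by
    rw [Ideal.map_span, ← Set.range_comp]
    rfl
  obtain ⟨φ, hφ, hφρ⟩ := exists_chart_index (A := CommRingCat.of (MvPolynomial (Fin (N + 1)) K ⧸ Ideal.span {Φ + Ψ})) hτ₀' g hg a
  haveI := hφ
  obtain ⟨χ, hχa, -⟩ := exists_chartEquiv_prime K Φ Ψ hΦ hΦ0 hΨ a G hG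
  -- the primes: `P̄ = P/(G)` and a maximal `𝔪 ⊋ P`
  have hkerP : RingHom.ker (Ideal.Quotient.mk (Ideal.span {G})) ≤ P := by
    rw [Ideal.mk_ker]
    exact (Ideal.span_singleton_le_iff_mem _).mpr (Ideal.pow_le_self two_ne_zero hGP)
  obtain ⟨𝔪, h𝔪, hP𝔪⟩ := Ideal.exists_le_maximal P hP.ne_top
  have hker𝔪 : RingHom.ker (Ideal.Quotient.mk (Ideal.span {G})) ≤ 𝔪 := hkerP.trans hP𝔪
  have hPne : P ≠ 𝔪 := fun h => hPmax (h ▸ h𝔪)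
  let Pb : Ideal (MvPolynomial (Fin (N + 1)) K ⧸ Ideal.span {G}) := P.map (Ideal.Quotient.mk (Ideal.span {G}))
  let Mb : Ideal (MvPolynomial (Fin (N + 1)) K ⧸ Ideal.span {G}) := 𝔪.map (Ideal.Quotient.mk (Ideal.span {G}))
  haveI hPb : Pb.IsPrime := Ideal.map_isPrime_of_surjective Ideal.Quotient.mk_surjective hkerP
  haveI hMb : Mb.IsPrime := Ideal.map_isPrime_of_surjective Ideal.Quotient.mk_surjective hker𝔪
  have hcomapP : Pb.comap (Ideal.Quotient.mk (Ideal.span {G})) = P := by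
    rw [Ideal.comap_map_of_surjective _ Ideal.Quotient.mk_surjective, sup_eq_left, ← RingHom.ker_eq_comap_bot]
    exact hkerP
  have hcomapM : Mb.comap (Ideal.Quotient.mk (Ideal.span {G})) = 𝔪 := by
    rw [Ideal.comap_map_of_surjective _ Ideal.Quotient.mk_surjective, sup_eq_left, ← RingHom.ker_eq_comap_bot]
    exact hker𝔪
  have hPbMb : Pb ≤ Mb := Ideal.map_mono hP𝔪
  have hPbne : Pb ≠ Mb := fun h => hPne (by rw [← hcomapP, ← hcomapM, h])
  -- the points `w ⤳ w₀` of the chart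
  let 𝔑 := Pb.map χ.toRingHom
  let 𝔑₀ := Mb.map χ.toRingHom
  have h𝔑 : 𝔑 = Pb.comap χ.symm.toRingHom := Ideal.map_comap_of_equiv (χ : _ ≃+* _)
  have h𝔑₀ : 𝔑₀ = Mb.comap χ.symm.toRingHom := Ideal.map_comap_of_equiv (χ : _ ≃+* _)
  haveI : 𝔑.IsPrime := by rw [h𝔑]; exact Ideal.comap_isPrime _ _
  haveI : 𝔑₀.IsPrime := by rw [h𝔑₀]; exact Ideal.comap_isPrime _ _
  let w : Spec (CommRingCat.of (blowupAlgebra ((Ideal.span (Set.range (X : Fin (N + 1) → MvPolynomial (Fin (N + 1)) K))).map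
      (Ideal.Quotient.mk (Ideal.span {Φ + Ψ}))) (Ideal.Quotient.mk (Ideal.span {Φ + Ψ}) (X a)))) := ⟨𝔑, inferInstance⟩
  let w₀ : Spec (CommRingCat.of (blowupAlgebra ((Ideal.span (Set.range (X : Fin (N + 1) → MvPolynomial (Fin (N + 1)) K))).map
      (Ideal.Quotient.mk (Ideal.span {Φ + Ψ}))) (Ideal.Quotient.mk (Ideal.span {Φ + Ψ}) (X a)))) := ⟨𝔑₀, inferInstance⟩
  have hmem𝔑 : ∀ x, x ∈ 𝔑 ↔ χ.symm x ∈ Pb := fun x => by rw [h𝔑, Ideal.mem_comap]; rfl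
  have hww₀ : w ⤳ w₀ := (PrimeSpectrum.le_iff_specializes w w₀).mp (Ideal.map_mono hPbMb)
  have hwne : w ≠ w₀ := by
    intro h
    apply hPbne
    have h' : 𝔑 = 𝔑₀ := congrArg PrimeSpectrum.asIdeal h
    rw [h𝔑, h𝔑₀] at h'
    exact Ideal.comap_injective_of_surjective _ χ.symm.surjective h'
  -- `T̄_a ∈ P̄`, so `ȳ_a ∈ 𝔑` and `φ w` lies over the origin
  have hya𝔑 : algebraMap (MvPolynomial (Fin (N + 1)) K ⧸ Ideal.span {Φ + Ψ}) _ (Ideal.Quotient.mk (Ideal.span {Φ + Ψ}) (X a)) ∈ 𝔑 := by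
    rw [← hχa]
    exact Ideal.mem_map_of_mem _ (Ideal.mem_map_of_mem _ haP)
  have hover : τ₀ (φ w) = y₀ := by
    have h1 : τ₀ (φ w) = (φ ≫ τ₀) w := rfl
    rw [h1, hφρ]
    apply PrimeSpectrum.ext
    rw [hy₀]
    change Ideal.comap (algebraMap (MvPolynomial (Fin (N + 1)) K ⧸ Ideal.span {Φ + Ψ}) _) 𝔑 = _
    refine (hmax.eq_of_le (Ideal.IsPrime.ne_top (Ideal.comap_isPrime _ 𝔑)) ?_).symm
    refine Ideal.map_le_iff_le_comap.mpr (Ideal.span_le.mpr (Set.range_subset_iff.mpr fun i => ?_))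
    rw [SetLike.mem_coe, Ideal.mem_comap, Ideal.mem_comap]
    have hi : Ideal.Quotient.mk (Ideal.span {Φ + Ψ}) (X i) ∈ (Ideal.span (Set.range (X : Fin (N + 1) → MvPolynomial (Fin (N + 1)) K))).map
        (Ideal.Quotient.mk (Ideal.span {Φ + Ψ})) := Ideal.mem_map_of_mem _ (Ideal.subset_span (Set.mem_range_self i))
    rw [← blowupAlgebra.algebraMap_mul_gen _ _ _ hi]
    exact Ideal.mul_mem_right _ _ hya𝔑
  -- the point `φ w` is NOT regular …
  have hnreg_loc : ¬ IsRegularLocalRing (Localization.AtPrime 𝔑) := by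
    intro hreg
    have hPbreg : IsRegularLocalRing (Localization.AtPrime Pb) :=
      OrdPoint.isRegularLocalRing_localization_of_ringEquiv χ.symm 𝔑 Pb (fun x => (hmem𝔑 x).symm) hreg
    exact not_isRegularLocalRing_localization_quotient_of_mem_sq (C := MvPolynomial (Fin (N + 1)) K) hG0 Pb (by rw [hcomapP]; exact hGP) hPbreg
  have hnreg : ¬ IsRegularLocalRing ((blowup (vanishingIdeal (⟨{y₀}, hy⟩ : Closeds (Spec (CommRingCat.of (MvPolynomial (Fin (N + 1)) K ⧸ Ideal.span {Φ + Ψ})))))).presheaf.stalk (φ w)) :=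
    fun h => hnreg_loc ((isRegularLocalRing_stalk_Spec_iff _ w).mp ((isRegularLocalRing_stalk_iff_of_isOpenImmersion φ w).mp h))
  -- … and NOT closed
  have hncl : ¬ IsClosed ({φ w} : Set (blowup (vanishingIdeal (⟨{y₀}, hy⟩ : Closeds (Spec (CommRingCat.of (MvPolynomial (Fin (N + 1)) K ⧸ Ideal.span {Φ + Ψ}))))))) := by
    intro hcl
    have hsp : φ w ⤳ φ w₀ := hww₀.map φ.continuous
    have hmem : φ w₀ ∈ ({φ w} : Set _) := hsp.mem_closed hcl (Set.mem_singleton _)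
    exact hwne (φ.isOpenEmbedding.injective (Set.mem_singleton_iff.mp hmem)).symm
  -- no level
  cases n with
  | zero =>
    intro hDn
    exact hnreg ((hD0 _ y₀ hy).mp hDn hy _ τ₀ hτ₀ (φ w) hover)
  | succ d =>
    intro hDn
    obtain ⟨S', hS'reg, hS'⟩ := (hDsucc d _ y₀ hy).mp hDn hy _ τ₀ hτ₀
    by_cases hmemS : φ w ∈ S'
    · exact hncl (hS' _ hmemS).2.1
    · exact hnreg (hS'reg _ hover hmemS)

/-- **Chart `1` of `x² + y³z + z⁵`** (`x := y₂`, `y := y₀`, `z := y₁`): `f(T₁T₀, T₁, T₁T₂) = T₁²·(T₂² + T₁²(T₀³ + T₁))` — the strict transform is singular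
along the LINE `T₁ = T₂ = 0` of the exceptional divisor. [cite: Hartshorne1977, II Ex. 7.12] -/
theorem E12blowup_strictTransform₁ :
    aeval (fun j => X 1 * Function.update (X : Fin 3 → MvPolynomial (Fin 3) K) 1 1 j)
        (X 2 ^ 2 + (X 0 ^ 3 * X 1 + X 1 ^ 5) : MvPolynomial (Fin 3) K) = X 1 ^ 2 * (X 2 ^ 2 + X 1 ^ 2 * (X 0 ^ 3 + X 1)) := by
  simp only [map_add, map_mul, map_pow, aeval_X, Function.update_self, Function.update_of_ne (by decide : (0 : Fin 3) ≠ 1),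
    Function.update_of_ne (by decide : (2 : Fin 3) ≠ 1)]
  ring

/-- ★★★ **`x² + y³z + z⁵` HAS NO BLOW-UP DEPTH** (every field, every blow-up tower): the origin of `Spec K[y]/(y₀³y₁ + y₁⁵ + y₂²)` — an isolated double
point, the first blow-up of the `E₁₂`-type point `x² + y³ + z⁷` — has no `D`-level, because chart `1` of its blow-up is singular along the line
`T₁ = T₂ = 0` inside the exceptional divisor. [OURS] [cite: StacksProject, Tag 0804] [cite: Matsumura1987, Thm. 14.2] -/
theorem towerLevel_none_origin_E12blowup (D : ℕ → ∀ Γ : Scheme.{0}, Γ → Prop)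
    (hD0 : ∀ (Γ : Scheme.{0}) (y : Γ), IsClosed (({y} : Set Γ)) →
      (D 0 Γ y ↔ ∀ (hy : IsClosed (({y} : Set Γ))) (Z : Scheme.{0}) (τ : Z ⟶ Γ), IsBlowup τ (vanishingIdeal ⟨{y}, hy⟩) →
        ∀ z : Z, τ z = y → IsRegularLocalRing (Z.presheaf.stalk z)))
    (hDsucc : ∀ (d : ℕ) (Γ : Scheme.{0}) (y : Γ), IsClosed (({y} : Set Γ)) →
      (D (d + 1) Γ y ↔ ∀ (hy : IsClosed (({y} : Set Γ))) (Z : Scheme.{0}) (τ : Z ⟶ Γ), IsBlowup τ (vanishingIdeal ⟨{y}, hy⟩) →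
        ∃ S' : Finset Z, (∀ z : Z, τ z = y → z ∉ S' → IsRegularLocalRing (Z.presheaf.stalk z)) ∧
          ∀ z ∈ S', τ z = y ∧ IsClosed (({z} : Set Z)) ∧ ∃ d' ≤ d, D d' Z z)) :
    ∀ (f : MvPolynomial (Fin 3) K), f = X 0 ^ 3 * X 1 + X 1 ^ 5 + X 2 ^ 2 →
      ∀ (y₀ : Spec (CommRingCat.of (MvPolynomial (Fin 3) K ⧸ Ideal.span {f}))),
        y₀.asIdeal = Ideal.map (Ideal.Quotient.mk (Ideal.span {f})) (Ideal.span (Set.range (X : Fin 3 → MvPolynomial (Fin 3) K))) →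
        ∀ n, ¬ D n (Spec (CommRingCat.of (MvPolynomial (Fin 3) K ⧸ Ideal.span {f}))) y₀ := by
  classical
  intro f hf y₀ hy₀ n
  have e : (X 2 ^ 2 : MvPolynomial (Fin 3) K) + (X 0 ^ 3 * X 1 + X 1 ^ 5) = f := by rw [hf]; ring
  subst e
  have hΦ : (X 2 ^ 2 : MvPolynomial (Fin 3) K).IsHomogeneous 2 := isHomogeneous_X_pow (2 : Fin 3) 2
  have hΦ0 : (X 2 ^ 2 : MvPolynomial (Fin 3) K) ≠ 0 := pow_ne_zero _ (X_ne_zero 2)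
  have hΨ : (X 0 ^ 3 * X 1 + X 1 ^ 5 : MvPolynomial (Fin 3) K) ∈ Ideal.span (Set.range (X : Fin 3 → MvPolynomial (Fin 3) K)) ^ (2 + 1) := by
    refine Ideal.add_mem _ ?_ ?_
    · simpa using SecondOrderPoint.monomial_mem_pow₃ K 3 1 0 (k := 2 + 1) (by norm_num)
    · simpa using SecondOrderPoint.monomial_mem_pow₃ K 0 5 0 (k := 2 + 1) (by norm_num)
  -- the prime `(T₁, T₂)`: prime, not maximal, contains `T₁`, and `G ∈ (T₁, T₂)²`
  let P : Ideal (MvPolynomial (Fin 3) K) := Ideal.span (X '' ({1, 2} : Set (Fin 3)))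
  haveI hP : P.IsPrime := Literature.RingTheory.MvPolynomial.isPrime_span_X_image _
  have hX1 : (X 1 : MvPolynomial (Fin 3) K) ∈ P := Literature.RingTheory.MvPolynomial.X_mem_span_X_image_iff.mpr (by simp)
  have hX2 : (X 2 : MvPolynomial (Fin 3) K) ∈ P := Literature.RingTheory.MvPolynomial.X_mem_span_X_image_iff.mpr (by simp)
  have hX0 : (X 0 : MvPolynomial (Fin 3) K) ∉ P := fun h =>
    absurd (Literature.RingTheory.MvPolynomial.X_mem_span_X_image_iff.mp h) (by simp)
  have hPmax : ¬ P.IsMaximal := by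
    intro hM
    let Q : Ideal (MvPolynomial (Fin 3) K) := Ideal.span (X '' (Set.univ : Set (Fin 3)))
    haveI hQ : Q.IsPrime := Literature.RingTheory.MvPolynomial.isPrime_span_X_image _
    have hPQ : P ≤ Q := Ideal.span_mono (Set.image_mono (Set.subset_univ _))
    have hEq : P = Q := hM.eq_of_le hQ.ne_top hPQ
    exact hX0 (hEq ▸ Literature.RingTheory.MvPolynomial.X_mem_span_X_image_iff.mpr (Set.mem_univ _))
  have hGP : (X 2 ^ 2 + X 1 ^ 2 * (X 0 ^ 3 + X 1) : MvPolynomial (Fin 3) K) ∈ P ^ 2 :=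
    Ideal.add_mem _ (Ideal.pow_mem_pow hX2 2) (Ideal.mul_mem_right _ _ (Ideal.pow_mem_pow hX1 2))
  have hG0 : (X 2 ^ 2 + X 1 ^ 2 * (X 0 ^ 3 + X 1) : MvPolynomial (Fin 3) K) ≠ 0 := by
    intro h
    have h1 := congrArg (eval (Pi.single (2 : Fin 3) (1 : K))) h
    simp at h1
  exact towerLevel_none_origin_of_mem_sq K D hD0 hDsucc (X 2 ^ 2) (X 0 ^ 3 * X 1 + X 1 ^ 5) (by norm_num) hΦ hΦ0 hΨ 1 _ hG0
    (E12blowup_strictTransform₁ K) P hPmax hX1 hGP y₀ hy₀ n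

end OneStep

end Summit.ResolutionOfSingularities.ResolutionOfSingularities.Cruxes.EquisingularLiftNat.Sections

end
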